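import Mathlib.Combinatorics.SetFamily.HarrisKleitman
import HarnessLib
import HarnessLib.Audit.Tags

/-!
# The comb hierarchy for Sahi's `E_k`: the FIVE-UP-SET INEQUALITY (typed conjecture) — the one-cube core of the thin-edge
# cells of the triangle class of (M⁺⁺-3); Kleitman's antipodal lemma and the proved faces

Support file of the one-cut programme (crux `NoHeavyLowerTail`, stmt-CriticalPhenomena-4575; cell `prim-masterthm`, seat P5 gen 6;
report `P5-LORENTZIAN-TEST.md` §11).  Self-contained finite combinatorics on the Boolean lattice `Finset α` with the antipode `s ↦ sᶜ`.

* `FiveUpSet.refl 𝒜` — the antipodal image `{sᶜ | s ∈ 𝒜}` of a family; `isLowerSet_refl`, `card_refl`, `refl_inter`, `refl_sdiff`;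
* **`FiveUpSet.card_inter_refl_le`** — KLEITMAN'S ANTIPODAL LEMMA: for up-sets `U`, `X` of the cube, `#(U ∩ refl X) ≤ #(U ∩ X)`
  (two Harris–Kleitman inequalities, Mathlib `IsUpperSet.card_inter_le_finset` / `le_card_inter_finset`, chained through `#U·#X / 2^n`);
* **`FiveUpSetIneq`** (`@[conjecture]`, an obligation of our theories, never a fact): for up-sets `P, A₀ ⊆ A₁, B₀ ⊆ B₁` of a finite cube,
  `#(P ∩ A₁ ∩ refl B₀) + #(P ∩ refl A₀ ∩ B₁) + #(P ∩ refl (A₁ \ A₀) ∩ refl (B₁ \ B₀)) ≤ #(P ∩ A₁ ∩ B₁) + #(P ∩ A₀ ∩ B₀)`.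
  CENSUS (report §11.3, engine `code6/spadeW.c`): EXHAUSTIVE over all `168 · 7581 · 7581 = 9 655 222 248` quintuples of up-sets of `2^4`,
  all of `2^≤3`, and `2·10^7` / `5·10^6` random quintuples of `2^5` / `2^6`: 0 violations, tight.  WHY IT MATTERS (report §11.1–11.3, proved
  on paper): specialised to cylinders over `Y × Z` it is exactly `P_x := D_y + D_z − D_xyz ≥ 0`, and `TRI = #(h ∩ C×D) + P_x`, so it gives
  the (M⁺⁺-3) coefficient `TRI ≥ 0` on every triangle-class cell with a block of size 1; and NO constant-coefficient combination of
  Harris/Kleitman inequalities proves it (report §11.5, §11.9: exact LP, kit j102250/j102309) — a matching (Hall) or multiplicative step is forced.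
* PROVED faces: `fiveUpSet_of_left_eq` (`A₀ = A₁`), `fiveUpSet_of_right_eq` (`B₀ = B₁`), `fiveUpSet_top` (`P` = all subsets) — each is two
  applications of Kleitman's lemma (plus inclusion–exclusion `card_shell_inter_add`).
HONEST LABEL: a typed conjecture with its trivial faces; the inequality itself, `TRI ≥ 0`, (M⁺⁺-3) and `C_3` stay OPEN. [this work]
-/

namespace Summit.CriticalPhenomena.PercolationContinuityZ3.Theorems

namespace FiveUpSet

open Finset

variable {α : Type*} [DecidableEq α] [Fintype α]

/-! ### The antipodal image of a family -/

/-- The antipodal (complement) image of a family of subsets: `refl 𝒜 = {sᶜ | s ∈ 𝒜}`. [this work] -/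
def refl (𝒜 : Finset (Finset α)) : Finset (Finset α) := 𝒜.map ⟨compl, compl_injective⟩

/-- Membership in the antipodal image. [this work] -/
theorem mem_refl {𝒜 : Finset (Finset α)} {s : Finset α} : s ∈ refl 𝒜 ↔ sᶜ ∈ 𝒜 := by
  unfold refl
  constructor
  · intro h
    obtain ⟨t, ht, rfl⟩ := Finset.mem_map.1 h
    simpa using ht
  · intro h
    exact Finset.mem_map.2 ⟨sᶜ, h, by simp⟩

/-- `refl` preserves cardinality. [this work] -/
theorem card_refl (𝒜 : Finset (Finset α)) : (refl 𝒜).card = 𝒜.card := by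
  unfold refl
  exact card_map _

/-- `refl` commutes with intersections. [this work] -/
theorem refl_inter (𝒜 ℬ : Finset (Finset α)) : refl (𝒜 ∩ ℬ) = refl 𝒜 ∩ refl ℬ := by
  ext s; simp only [mem_refl, mem_inter]

/-- `refl` commutes with set differences. [this work] -/
theorem refl_sdiff (𝒜 ℬ : Finset (Finset α)) : refl (𝒜 \ ℬ) = refl 𝒜 \ refl ℬ := by
  ext s; simp only [mem_refl, mem_sdiff]

/-- The antipodal image of an up-set is a down-set. [this work] -/
theorem isLowerSet_refl {𝒜 : Finset (Finset α)} (h : IsUpperSet (𝒜 : Set (Finset α))) :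
    IsLowerSet (refl 𝒜 : Set (Finset α)) := by
  intro s t hts hs
  rw [mem_coe, mem_refl] at hs ⊢
  exact h (compl_subset_compl.2 hts) hs

/-! ### Kleitman's antipodal lemma -/

/-- **Kleitman's antipodal lemma.** For up-sets `U, X` of the cube, `#(U ∩ refl X) ≤ #(U ∩ X)`: inside an up-set, the antipodal image
of an up-set is met no more often than the up-set itself.  Proof: `2^n·#(U ∩ refl X) ≤ #U·#(refl X) = #U·#X ≤ 2^n·#(U ∩ X)` by the two
Harris–Kleitman inequalities (Mathlib `IsUpperSet.card_inter_le_finset`, `IsUpperSet.le_card_inter_finset`). [this work] -/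
theorem card_inter_refl_le {U X : Finset (Finset α)} (hU : IsUpperSet (U : Set (Finset α)))
    (hX : IsUpperSet (X : Set (Finset α))) : (U ∩ refl X).card ≤ (U ∩ X).card := by
  have h1 : 2 ^ Fintype.card α * (U ∩ refl X).card ≤ U.card * (refl X).card :=
    hU.card_inter_le_finset (isLowerSet_refl hX)
  have h2 : U.card * X.card ≤ 2 ^ Fintype.card α * (U ∩ X).card := hU.le_card_inter_finset hX
  rw [card_refl] at h1
  exact Nat.le_of_mul_le_mul_left (h1.trans h2) (Nat.pos_of_ne_zero (by simp))

/-- Kleitman's lemma with the antipodal factor on the left: `#(refl X ∩ U) ≤ #(X ∩ U)`. [this work] -/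
theorem card_refl_inter_le {U X : Finset (Finset α)} (hU : IsUpperSet (U : Set (Finset α)))
    (hX : IsUpperSet (X : Set (Finset α))) : (refl X ∩ U).card ≤ (X ∩ U).card := by
  rw [inter_comm, inter_comm X]
  exact card_inter_refl_le hU hX

/-! ### The conjecture -/

/-- **The five-up-set inequality** (CONJECTURE, report §11.3; an obligation of our theories, never a fact).  For up-sets
`P, A₀ ⊆ A₁, B₀ ⊆ B₁` of a finite cube, with `refl` the antipodal image:
`#(P ∩ A₁ ∩ refl B₀) + #(P ∩ refl A₀ ∩ B₁) + #(P ∩ refl (A₁ \ A₀) ∩ refl (B₁ \ B₀)) ≤ #(P ∩ A₁ ∩ B₁) + #(P ∩ A₀ ∩ B₀)`.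
Census: exhaustive on `2^n`, `n ≤ 4` (9.66e9 quintuples), sampled `n = 5, 6`: 0 violations, tight.  Equivalent (Strassen/Hall) to a
monotone injection `(A₁ ∩ refl B₀) ⊔ (refl A₀ ∩ B₁) ⊔ refl((A₁\A₀) ∩ (B₁\B₀)) → (A₁ ∩ B₀) ⊔ (A₀ ∩ B₁) ⊔ ((A₁\A₀) ∩ (B₁\B₀))`.
Its cylinder specialisation is the thin-edge case of the (M⁺⁺-3) triangle-class coefficient `TRI ≥ 0` (report §11.1–11.3). [this work] -/
@[conjecture] def FiveUpSetIneq : Prop :=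
  ∀ (α : Type) [DecidableEq α] [Fintype α] (P A₀ A₁ B₀ B₁ : Finset (Finset α)),
    IsUpperSet (P : Set (Finset α)) → IsUpperSet (A₀ : Set (Finset α)) → IsUpperSet (A₁ : Set (Finset α)) →
    IsUpperSet (B₀ : Set (Finset α)) → IsUpperSet (B₁ : Set (Finset α)) → A₀ ⊆ A₁ → B₀ ⊆ B₁ →
      (P ∩ A₁ ∩ refl B₀).card + (P ∩ refl A₀ ∩ B₁).card + (P ∩ refl (A₁ \ A₀) ∩ refl (B₁ \ B₀)).card
        ≤ (P ∩ A₁ ∩ B₁).card + (P ∩ A₀ ∩ B₀).card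

/-! ### Proved faces -/

omit [Fintype α] in
/-- Inclusion–exclusion for the shell box: `#(S ∩ (A₁\A₀) ∩ (B₁\B₀)) + #(S ∩ A₁ ∩ B₀) + #(S ∩ A₀ ∩ B₁) = #(S ∩ A₁ ∩ B₁) + #(S ∩ A₀ ∩ B₀)`
for `A₀ ⊆ A₁`, `B₀ ⊆ B₁` and any family `S`. [this work] -/
theorem card_shell_inter_add (S A₀ A₁ B₀ B₁ : Finset (Finset α)) (hA : A₀ ⊆ A₁) (hB : B₀ ⊆ B₁) :
    (S ∩ (A₁ \ A₀) ∩ (B₁ \ B₀)).card + (S ∩ A₁ ∩ B₀).card + (S ∩ A₀ ∩ B₁).card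
      = (S ∩ A₁ ∩ B₁).card + (S ∩ A₀ ∩ B₀).card := by
  -- `S ∩ A₁ ∩ B₁` is the disjoint union of the shell box and `E := (S ∩ A₁ ∩ B₀) ∪ (S ∩ A₀ ∩ B₁)`, whose two parts meet in `S ∩ A₀ ∩ B₀`.
  have hE : (S ∩ A₁ ∩ B₀ ∪ S ∩ A₀ ∩ B₁).card + (S ∩ A₀ ∩ B₀).card = (S ∩ A₁ ∩ B₀).card + (S ∩ A₀ ∩ B₁).card := by
    have h := card_union_add_card_inter (S ∩ A₁ ∩ B₀) (S ∩ A₀ ∩ B₁)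
    have hi : S ∩ A₁ ∩ B₀ ∩ (S ∩ A₀ ∩ B₁) = S ∩ A₀ ∩ B₀ := by
      ext s; simp only [mem_inter]
      constructor
      · rintro ⟨⟨⟨hs, -⟩, hb⟩, ⟨-, ha⟩, -⟩; exact ⟨⟨hs, ha⟩, hb⟩
      · rintro ⟨⟨hs, ha⟩, hb⟩; exact ⟨⟨⟨hs, hA ha⟩, hb⟩, ⟨hs, ha⟩, hB hb⟩
    rw [hi] at h
    exact h
  have hU : S ∩ A₁ ∩ B₁ = (S ∩ (A₁ \ A₀) ∩ (B₁ \ B₀)) ∪ (S ∩ A₁ ∩ B₀ ∪ S ∩ A₀ ∩ B₁) := by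
    ext s; simp only [mem_inter, mem_union, mem_sdiff]
    constructor
    · rintro ⟨⟨hs, ha1⟩, hb1⟩
      by_cases ha0 : s ∈ A₀
      · exact Or.inr (Or.inr ⟨⟨hs, ha0⟩, hb1⟩)
      · by_cases hb0 : s ∈ B₀
        · exact Or.inr (Or.inl ⟨⟨hs, ha1⟩, hb0⟩)
        · exact Or.inl ⟨⟨hs, ha1, ha0⟩, hb1, hb0⟩
    · rintro (⟨⟨hs, ha1, -⟩, hb1, -⟩ | ⟨⟨hs, ha1⟩, hb0⟩ | ⟨⟨hs, ha0⟩, hb1⟩)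
      · exact ⟨⟨hs, ha1⟩, hb1⟩
      · exact ⟨⟨hs, ha1⟩, hB hb0⟩
      · exact ⟨⟨hs, hA ha0⟩, hb1⟩
  have hd : Disjoint (S ∩ (A₁ \ A₀) ∩ (B₁ \ B₀)) (S ∩ A₁ ∩ B₀ ∪ S ∩ A₀ ∩ B₁) := by
    rw [disjoint_left]
    intro s hs hs'
    simp only [mem_inter, mem_union, mem_sdiff] at hs hs'
    rcases hs' with ⟨⟨-, -⟩, hb0⟩ | ⟨⟨-, ha0⟩, -⟩
    · exact hs.2.2 hb0
    · exact hs.1.2.2 ha0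
  rw [hU, card_union_of_disjoint hd]
  omega

/-- The face `A₀ = A₁` of the five-up-set inequality (then the shell box is empty): two applications of Kleitman's lemma. [this work] -/
theorem fiveUpSet_of_left_eq (P A B₀ B₁ : Finset (Finset α)) (hP : IsUpperSet (P : Set (Finset α)))
    (hA : IsUpperSet (A : Set (Finset α))) (hB₀ : IsUpperSet (B₀ : Set (Finset α))) (hB₁ : IsUpperSet (B₁ : Set (Finset α))) :
    (P ∩ A ∩ refl B₀).card + (P ∩ refl A ∩ B₁).card + (P ∩ refl (A \ A) ∩ refl (B₁ \ B₀)).card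
      ≤ (P ∩ A ∩ B₁).card + (P ∩ A ∩ B₀).card := by
  have h0 : (P ∩ refl (A \ A) ∩ refl (B₁ \ B₀)).card = 0 := by
    rw [sdiff_self, Finset.bot_eq_empty]
    simp [refl]
  have hPA : IsUpperSet ((P ∩ A : Finset (Finset α)) : Set (Finset α)) := by
    rw [coe_inter]; exact hP.inter hA
  have hPB : IsUpperSet ((P ∩ B₁ : Finset (Finset α)) : Set (Finset α)) := by
    rw [coe_inter]; exact hP.inter hB₁
  have h1 : (P ∩ A ∩ refl B₀).card ≤ (P ∩ A ∩ B₀).card := card_inter_refl_le hPA hB₀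
  have h2 : (P ∩ refl A ∩ B₁).card ≤ (P ∩ A ∩ B₁).card := by
    have h := card_inter_refl_le hPB hA
    have e1 : P ∩ refl A ∩ B₁ = P ∩ B₁ ∩ refl A := by rw [inter_assoc, inter_comm (refl A), ← inter_assoc]
    have e2 : P ∩ A ∩ B₁ = P ∩ B₁ ∩ A := by rw [inter_assoc, inter_comm A, ← inter_assoc]
    rw [e1, e2]; exact h
  omega

/-- The face `B₀ = B₁` of the five-up-set inequality: two applications of Kleitman's lemma. [this work] -/
theorem fiveUpSet_of_right_eq (P A₀ A₁ B : Finset (Finset α)) (hP : IsUpperSet (P : Set (Finset α)))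
    (hA₀ : IsUpperSet (A₀ : Set (Finset α))) (hA₁ : IsUpperSet (A₁ : Set (Finset α))) (hB : IsUpperSet (B : Set (Finset α))) :
    (P ∩ A₁ ∩ refl B).card + (P ∩ refl A₀ ∩ B).card + (P ∩ refl (A₁ \ A₀) ∩ refl (B \ B)).card
      ≤ (P ∩ A₁ ∩ B).card + (P ∩ A₀ ∩ B).card := by
  have h0 : (P ∩ refl (A₁ \ A₀) ∩ refl (B \ B)).card = 0 := by
    rw [sdiff_self, Finset.bot_eq_empty]
    simp [refl]
  have hPA : IsUpperSet ((P ∩ A₁ : Finset (Finset α)) : Set (Finset α)) := by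
    rw [coe_inter]; exact hP.inter hA₁
  have hPB : IsUpperSet ((P ∩ B : Finset (Finset α)) : Set (Finset α)) := by
    rw [coe_inter]; exact hP.inter hB
  have h1 : (P ∩ A₁ ∩ refl B).card ≤ (P ∩ A₁ ∩ B).card := card_inter_refl_le hPA hB
  have h2 : (P ∩ refl A₀ ∩ B).card ≤ (P ∩ A₀ ∩ B).card := by
    have h := card_inter_refl_le hPB hA₀
    have e1 : P ∩ refl A₀ ∩ B = P ∩ B ∩ refl A₀ := by rw [inter_assoc, inter_comm (refl A₀), ← inter_assoc]
    have e2 : P ∩ A₀ ∩ B = P ∩ B ∩ A₀ := by rw [inter_assoc, inter_comm A₀, ← inter_assoc]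
    rw [e1, e2]; exact h
  omega

/-- The face `P = ⊤` (all subsets) of the five-up-set inequality: inclusion–exclusion for the shell box, `#(refl 𝒜) = #𝒜`, and two
applications of Kleitman's lemma. [this work] -/
theorem fiveUpSet_top (A₀ A₁ B₀ B₁ : Finset (Finset α))
    (hA₀ : IsUpperSet (A₀ : Set (Finset α))) (hA₁ : IsUpperSet (A₁ : Set (Finset α)))
    (hB₀ : IsUpperSet (B₀ : Set (Finset α))) (hB₁ : IsUpperSet (B₁ : Set (Finset α))) (hA : A₀ ⊆ A₁) (hB : B₀ ⊆ B₁) :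
    (A₁ ∩ refl B₀).card + (refl A₀ ∩ B₁).card + (refl (A₁ \ A₀) ∩ refl (B₁ \ B₀)).card
      ≤ (A₁ ∩ B₁).card + (A₀ ∩ B₀).card := by
  -- the fully reflected shell box has the cardinality of the shell box
  have h3 : (refl (A₁ \ A₀) ∩ refl (B₁ \ B₀)).card = ((A₁ \ A₀) ∩ (B₁ \ B₀)).card := by
    rw [← refl_inter, card_refl]
  -- inclusion–exclusion with `S = univ`
  have hie := card_shell_inter_add (Finset.univ : Finset (Finset α)) A₀ A₁ B₀ B₁ hA hB
  simp only [univ_inter] at hie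
  have h1 : (A₁ ∩ refl B₀).card ≤ (A₁ ∩ B₀).card := card_inter_refl_le hA₁ hB₀
  have h2 : (refl A₀ ∩ B₁).card ≤ (A₀ ∩ B₁).card := card_refl_inter_le hB₁ hA₀
  omega

end FiveUpSet

end Summit.CriticalPhenomena.PercolationContinuityZ3.Theorems
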